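import Mathlib
import Literature.Combinatorics.Additive.TripleProductProperty
import Literature.Barriers.MatrixMultiplication.YoungSubgroupBarrierProofs

/-!
# Young subgroups of labellings: exact order, meets, big cells, restriction and cost transfer

Combinatorial toolkit for `Negative/ThinnedYoungDeath.lean` (crux stmt-MatrixMultiplication-10882, line lead c2,
2026-08-17; `sorry`-free, standard axioms), complementing the tree's `YoungSubgroupCounting.lean`:

* `card_youngSubgroup_eq` — `|youngSubgroup h| = ∏_b |h⁻¹(b)|!` (Mathlib `DomMulAct.stabilizer_card'`);
  `youngSubgroup_pair_eq_inf` (the pair labelling gives the meet), `mem_youngSubgroup_comp_inv` /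
  `card_youngSubgroup_comp_inv` (relabelling through `g⁻¹` conjugates; same order).
* big points = points in cells of size `≥ 2` (`univ.filter fun x => 2 ≤ #cell(x)`); `two_pow_card_bigPts_le`:
  `2^{#big} ≤ |youngSubgroup h|²`.
* restriction to a kept set `P` (`x' ↦ h (P.equivFin.symm x')`); `inf_eq_bot_restrict`: if no kept point is big for the pair
  labelling, the restricted Young subgroups meet trivially (the hypothesis of BCCGU 2017 Thm 4.2's core).
* `pair_of_tpp₁/₂` — the two-set consequences of `TPP(S, gS, g²S)` used by thinned-coset packing.
* the COST TRANSFER `sum_cost_le_restrict` (any per-point cost with `cost ≤ log`, `cost(a) − cost(a') ≤ 2(a − a')/a'`;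
  the core's `log a − 1 + (1 + log a)/a` qualifies by `cost_le_log_nat`, `cost_sub_cost_le`):
  `∑_x cost(a(x)) ≤ ∑_{x'} cost(a'(x')) + |Pᶜ|·(log n + 2)` (double count `sum_ratio_le`).

No definitions are introduced (statements are written with explicit filters).

Reference for the surrounding argument: Blasiak–Church–Cohn–Grochow–Umans 2017 (arXiv:1712.02302) §4 Thm 4.2.
-/

set_option linter.dupNamespace false

noncomputable section

open Finset Real

namespace Summit.MatrixMultiplication.MatrixMultiplication.Theorems.ThresholdSubsetTriples.Negative

open Literature.Combinatorics.Additive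
open Literature.Barriers.MatrixMultiplication

variable {n : ℕ}

/-! ### Pair conditions from the triple product property of a translate triple -/

section Meets

variable {G : Type*} [Group G] [DecidableEq G]

/-- Pair condition for `(S, gS)` from the triple product property of `(S, gS, g²S)`. -/
theorem pair_of_tpp₁ {S : Finset G} {g : G}
    (hT : TripleProductProperty S (S.image (g * ·)) (S.image (g * g * ·))) :
    ∀ s ∈ S, ∀ s' ∈ S, ∀ t ∈ S, ∀ t' ∈ S, s * s'⁻¹ * (g * t * (g * t')⁻¹) = 1 → s = s' ∧ t = t' := by
  intro s hs s' hs' t ht t' ht' h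
  have key := hT s hs s' hs' (g * t) (Finset.mem_image_of_mem _ ht) (g * t') (Finset.mem_image_of_mem _ ht')
    (g * g * s) (Finset.mem_image_of_mem _ hs) (g * g * s) (Finset.mem_image_of_mem _ hs)
    (by rw [mul_inv_cancel, mul_one]; exact h)
  exact ⟨key.1, mul_left_cancel key.2.1⟩

/-- Pair condition for `(S, g²S)` from the triple product property of `(S, gS, g²S)`. -/
theorem pair_of_tpp₂ {S : Finset G} {g : G}
    (hT : TripleProductProperty S (S.image (g * ·)) (S.image (g * g * ·))) :
    ∀ s ∈ S, ∀ s' ∈ S, ∀ t ∈ S, ∀ t' ∈ S,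
      s * s'⁻¹ * (g * g * t * (g * g * t')⁻¹) = 1 → s = s' ∧ t = t' := by
  intro s hs s' hs' t ht t' ht' h
  have key := hT s hs s' hs' (g * s) (Finset.mem_image_of_mem _ hs) (g * s) (Finset.mem_image_of_mem _ hs)
    (g * g * t) (Finset.mem_image_of_mem _ ht) (g * g * t') (Finset.mem_image_of_mem _ ht')
    (by rw [mul_inv_cancel, mul_one]; exact h)
  exact ⟨key.1, mul_left_cancel key.2.2⟩

end Meets


/-! ### A. Young subgroups of labellings: exact order, meets, conjugates, big cells -/

/-- Exact order of a Young subgroup: `|youngSubgroup h| = ∏_b |h⁻¹(b)|!` (Mathlib's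
`DomMulAct.stabilizer_card'`). -/
theorem card_youngSubgroup_eq {n : ℕ} {ι : Type*} [DecidableEq ι] (h : Fin n → ι) :
    Nat.card (youngSubgroup h) = ∏ i ∈ univ.image h, ((univ.filter fun y => h y = i).card).factorial := by
  classical
  have e : (youngSubgroup h) ≃ {σ : Equiv.Perm (Fin n) // h ∘ σ = h} :=
    { toFun := fun σ => ⟨σ.1, funext fun x => mem_youngSubgroup.1 σ.2 x⟩
      invFun := fun σ => ⟨σ.1, mem_youngSubgroup.2 fun x => congr_fun σ.2 x⟩
      left_inv := fun σ => rfl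
      right_inv := fun σ => rfl }
  rw [Nat.card_congr e, Nat.card_eq_fintype_card, DomMulAct.stabilizer_card' h]
  refine Finset.prod_congr rfl fun i _ => ?_
  rw [Fintype.card_subtype]

/-- The Young subgroup of the pair labelling is the meet of the two Young subgroups. -/
theorem youngSubgroup_pair_eq_inf {ι κ : Type*} (h₁ : Fin n → ι) (h₂ : Fin n → κ) :
    youngSubgroup (fun x => (h₁ x, h₂ x)) = youngSubgroup h₁ ⊓ youngSubgroup h₂ := by
  ext σ
  simp only [Subgroup.mem_inf, mem_youngSubgroup, Prod.mk.injEq]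
  exact ⟨fun H => ⟨fun x => (H x).1, fun x => (H x).2⟩, fun H x => ⟨H.1 x, H.2 x⟩⟩

/-- Relabelling through `g⁻¹` conjugates the Young subgroup: `σ ∈ Y_{h ∘ g⁻¹} ↔ g⁻¹ σ g ∈ Y_h`. -/
theorem mem_youngSubgroup_comp_inv {ι : Type*} (h : Fin n → ι) (g σ : Equiv.Perm (Fin n)) :
    σ ∈ youngSubgroup (h ∘ ⇑g⁻¹) ↔ g⁻¹ * σ * g ∈ youngSubgroup h := by
  simp only [mem_youngSubgroup, Function.comp_apply, Equiv.Perm.mul_apply]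
  constructor
  · intro H x
    simpa using H (g x)
  · intro H x
    have := H (g⁻¹ x)
    simpa using this

/-- Conjugate Young subgroups have the same order. -/
theorem card_youngSubgroup_comp_inv {ι : Type*} (h : Fin n → ι) (g : Equiv.Perm (Fin n)) :
    Nat.card (youngSubgroup (h ∘ ⇑g⁻¹)) = Nat.card (youngSubgroup h) := by
  refine Nat.card_congr
    { toFun := fun σ => ⟨g⁻¹ * σ.1 * g, (mem_youngSubgroup_comp_inv h g σ.1).1 σ.2⟩
      invFun := fun τ => ⟨g * τ.1 * g⁻¹, (mem_youngSubgroup_comp_inv h g _).2 (by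
        simp [mul_assoc])⟩
      left_inv := fun σ => by ext1; simp [mul_assoc]
      right_inv := fun τ => by ext1; simp [mul_assoc] }



/-- `2^m ≤ (m!)²` for `m ≥ 2`. -/
theorem two_pow_le_factorial_sq {m : ℕ} (hm : 2 ≤ m) : 2 ^ m ≤ m.factorial ^ 2 := by
  induction m with
  | zero => omega
  | succ k ih =>
    rcases Nat.lt_or_ge k 2 with hk | hk
    · interval_cases k
      · omega
      · simp [Nat.factorial]
    · have h1 := ih hk
      have h2 : 2 ≤ (k + 1) ^ 2 := by nlinarith
      calc 2 ^ (k + 1) = 2 ^ k * 2 := pow_succ 2 k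
        _ ≤ k.factorial ^ 2 * (k + 1) ^ 2 := Nat.mul_le_mul h1 h2
        _ = (k + 1).factorial ^ 2 := by rw [Nat.factorial_succ, mul_pow, mul_comm]

/-- **Big cells are paid in the order**: `2^{#big points} ≤ |youngSubgroup h|²`. -/
theorem two_pow_card_bigPts_le {ι : Type*} [DecidableEq ι] (h : Fin n → ι) :
    2 ^ (univ.filter fun x => 2 ≤ (univ.filter fun y => h y = h x).card).card ≤
      (Nat.card (youngSubgroup h)) ^ 2 := by
  classical
  rw [card_youngSubgroup_eq, ← Finset.prod_pow]
  have hcount : (univ.filter fun x => 2 ≤ (univ.filter fun y => h y = h x).card).card = ∑ i ∈ univ.image h,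
      (if 2 ≤ (univ.filter fun y => h y = i).card then (univ.filter fun y => h y = i).card else 0) := by
    rw [card_eq_sum_card_fiberwise (f := h) (t := univ.image h)
      (fun x _ => Finset.mem_coe.2 (mem_image_of_mem h (mem_univ x)))]
    refine Finset.sum_congr rfl fun i _ => ?_
    split_ifs with h2
    · congr 1
      ext x
      simp only [mem_filter, mem_univ, true_and]
      constructor
      · rintro ⟨-, rfl⟩; rfl
      · rintro rfl; exact ⟨h2, rfl⟩
    · rw [Finset.card_eq_zero, Finset.filter_eq_empty_iff]
      rintro x hx
      simp only [mem_filter, mem_univ, true_and] at hx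
      rintro rfl
      exact h2 hx
  rw [hcount, ← Finset.prod_pow_eq_pow_sum]
  refine Finset.prod_le_prod (fun i _ => by positivity) fun i _ => ?_
  split_ifs with h2
  · exact two_pow_le_factorial_sq h2
  · simpa using Nat.one_le_iff_ne_zero.2 (by positivity)

/-- Two distinct points with the same label are both big. -/
theorem mem_bigPts_of_ne {ι : Type*} [DecidableEq ι] (h : Fin n → ι) {x y : Fin n} (hxy : x ≠ y)
    (hl : h x = h y) : x ∈ (univ.filter fun x => 2 ≤ (univ.filter fun y => h y = h x).card) := by
  simp only [mem_filter, mem_univ, true_and]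
  have hsub : ({x, y} : Finset (Fin n)) ⊆ univ.filter fun z => h z = h x := by
    intro z hz
    simp only [mem_insert, mem_singleton] at hz
    rcases hz with rfl | rfl <;> simp [hl]
  exact (Finset.card_pair hxy).symm.le.trans (Finset.card_le_card hsub)


/-! ### B. Restriction of labellings to a kept set of points; transfer of the per-point costs -/


/-- The restricted block of `x'` is `P ∩ (block of x)`. -/
theorem card_block_restrictLab {ι : Type*} [DecidableEq ι] (h : Fin n → ι) (P : Finset (Fin n))
    (x' : Fin P.card) :
    (univ.filter fun y' : Fin P.card =>
        h ((P.equivFin.symm y' : P) : Fin n) = h ((P.equivFin.symm x' : P) : Fin n)).card =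
      (P.filter fun y => h y = h ((P.equivFin.symm x' : P) : Fin n)).card := by
  refine Finset.card_bij (fun y' _ => ((P.equivFin.symm y' : P) : Fin n)) ?_ ?_ ?_
  · intro y' hy'
    simp only [mem_filter, mem_univ, true_and] at hy' ⊢
    exact ⟨Finset.coe_mem _, hy'⟩
  · intro y₁ _ y₂ _ hEq
    exact P.equivFin.symm.injective (Subtype.ext hEq)
  · intro y hy
    simp only [mem_filter] at hy
    refine ⟨P.equivFin ⟨y, hy.1⟩, ?_, ?_⟩
    · simp only [mem_filter, mem_univ, true_and, Equiv.symm_apply_apply]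
      exact hy.2
    · simp

/-- If no kept point is big for the pair labelling `(h₁, h₂)`, the restricted Young subgroups meet
trivially. -/
theorem inf_eq_bot_restrict {ι κ : Type*} [DecidableEq ι] [DecidableEq κ] (h₁ : Fin n → ι)
    (h₂ : Fin n → κ) (P : Finset (Fin n))
    (hP : ∀ x ∈ P, x ∉ (univ.filter fun x => 2 ≤ (univ.filter fun y => (h₁ y, h₂ y) = (h₁ x, h₂ x)).card)) :
    youngSubgroup (fun x : Fin P.card => h₁ ((P.equivFin.symm x : P) : Fin n)) ⊓
      youngSubgroup (fun x : Fin P.card => h₂ ((P.equivFin.symm x : P) : Fin n)) = ⊥ := by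
  rw [Subgroup.eq_bot_iff_forall]
  intro σ hσ
  rw [Subgroup.mem_inf, mem_youngSubgroup, mem_youngSubgroup] at hσ
  refine Equiv.ext fun x' => ?_
  by_contra hne
  set e := P.equivFin.symm with he
  have hne' : ((e x' : P) : Fin n) ≠ ((e (σ x') : P) : Fin n) := by
    intro H
    exact hne (e.injective (Subtype.ext H)).symm
  have hbig := mem_bigPts_of_ne (fun z => (h₁ z, h₂ z)) hne' (by
      simp only [Prod.mk.injEq]
      exact ⟨(hσ.1 x').symm, (hσ.2 x').symm⟩)
  exact hP _ (Finset.coe_mem _) hbig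


/-- `cost a ≤ log a` for naturals `a ≥ 1`. -/
theorem cost_le_log_nat {a : ℕ} (ha : 1 ≤ a) :
    Real.log (a : ℝ) - 1 + (1 + Real.log (a : ℝ)) / (a : ℝ) ≤ Real.log a :=
  cost_le_log (by exact_mod_cast ha)

/-- Shrinking a block from `a` to `b ≥ 1` points lowers the cost by at most `2(a-b)/b`. -/
theorem cost_sub_cost_le {a b : ℕ} (hb : 1 ≤ b) (hab : b ≤ a) :
    (Real.log (a : ℝ) - 1 + (1 + Real.log (a : ℝ)) / (a : ℝ)) -
      (Real.log (b : ℝ) - 1 + (1 + Real.log (b : ℝ)) / (b : ℝ)) ≤ 2 * (((a - b : ℕ) : ℝ) / b) := by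
  have hb0 : (0 : ℝ) < b := by exact_mod_cast hb
  have ha0 : (0 : ℝ) < a := by exact_mod_cast (lt_of_lt_of_le hb hab)
  have hab' : (b : ℝ) ≤ a := by exact_mod_cast hab
  have hlog : Real.log b ≤ Real.log a := Real.log_le_log hb0 hab'
  have hloga : 0 ≤ Real.log a := Real.log_nonneg (by exact_mod_cast (le_trans hb hab))
  -- `log a - log b = log (a/b) ≤ a/b - 1 = (a-b)/b`
  have hdiff : Real.log a - Real.log b ≤ ((a - b : ℕ) : ℝ) / b := by
    rw [← Real.log_div ha0.ne' hb0.ne', Nat.cast_sub hab, sub_div, div_self hb0.ne']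
    exact Real.log_le_sub_one_of_pos (div_pos ha0 hb0)
  -- the correction term is monotone enough: `(1+log a)/a ≤ (1+log a)/b`
  have hcorr : (1 + Real.log a) / a - (1 + Real.log b) / b ≤ Real.log a - Real.log b := by
    have h1 : (1 + Real.log a) / a ≤ (1 + Real.log a) / b :=
      div_le_div_of_nonneg_left (by linarith) hb0 hab'
    have h2 : (1 + Real.log a) / b - (1 + Real.log b) / b = (Real.log a - Real.log b) / b := by
      field_simp
      ring
    have h3 : (Real.log a - Real.log b) / b ≤ Real.log a - Real.log b :=
      div_le_self (by linarith) (by exact_mod_cast hb)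
    linarith
  linarith

/-- Splitting a block count along `P` and its complement. -/
theorem card_block_split {ι : Type*} [DecidableEq ι] (h : Fin n → ι) (P : Finset (Fin n)) (i : ι) :
    (univ.filter fun y => h y = i).card =
      (P.filter fun y => h y = i).card + (Pᶜ.filter fun y => h y = i).card := by
  rw [← Finset.card_union_of_disjoint, ← Finset.filter_union, Finset.union_compl]
  exact Finset.disjoint_filter_filter (disjoint_compl_right (a := P))

/-- The double-counting step: `∑_{x ∈ P} #(Pᶜ ∩ block x)/#(P ∩ block x) ≤ |Pᶜ|`. -/
theorem sum_ratio_le {ι : Type*} [DecidableEq ι] (h : Fin n → ι) (P : Finset (Fin n)) :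
    ∑ x ∈ P, (((Pᶜ.filter fun y => h y = h x).card : ℕ) : ℝ) / (P.filter fun y => h y = h x).card
      ≤ (Pᶜ.card : ℝ) := by
  have hrew : ∀ x ∈ P,
      (((Pᶜ.filter fun y => h y = h x).card : ℕ) : ℝ) / (P.filter fun y => h y = h x).card =
        ∑ y ∈ Pᶜ, if h y = h x then (1 : ℝ) / (P.filter fun z => h z = h y).card else 0 := by
    intro x _
    rw [Finset.sum_ite, Finset.sum_const_zero, add_zero]
    have : ∑ y ∈ Pᶜ.filter (fun y => h y = h x), (1 : ℝ) / (P.filter fun z => h z = h y).card =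
        ∑ y ∈ Pᶜ.filter (fun y => h y = h x), (1 : ℝ) / (P.filter fun z => h z = h x).card := by
      refine Finset.sum_congr rfl fun y hy => ?_
      rw [(Finset.mem_filter.1 hy).2]
    rw [this, Finset.sum_const, nsmul_eq_mul]
    ring
  rw [Finset.sum_congr rfl hrew, Finset.sum_comm]
  have hinner : ∀ y ∈ Pᶜ,
      (∑ x ∈ P, if h y = h x then (1 : ℝ) / (P.filter fun z => h z = h y).card else 0) ≤ 1 := by
    intro y _
    rw [Finset.sum_ite, Finset.sum_const_zero, add_zero, Finset.sum_const, nsmul_eq_mul]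
    have hset : (P.filter fun x => h y = h x) = P.filter fun z => h z = h y := by
      ext z; simp only [mem_filter, eq_comm]
    rw [hset]
    rcases Nat.eq_zero_or_pos (P.filter fun z => h z = h y).card with h0 | hpos
    · rw [h0]; simp
    · rw [mul_one_div, div_self]
      exact_mod_cast hpos.ne'
  calc _ ≤ ∑ y ∈ Pᶜ, (1 : ℝ) := Finset.sum_le_sum hinner
    _ = (Pᶜ.card : ℝ) := by simp

/-- **Cost transfer to the kept points**: for any per-point cost `cost : ℕ → ℝ` with `cost a ≤ log a` and
`cost a − cost b ≤ 2(a−b)/b` (`1 ≤ b ≤ a`) — e.g. the cost `log a − 1 + (1 + log a)/a` of the analytic core of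
BCCGU 2017 Thm 4.2 (`cost_le_log_nat`, `cost_sub_cost_le`) — deleting the points outside `P` changes the total
`∑_x cost(a(x))` (block sizes `a`) by at most `|Pᶜ|·(log n + 2)`. -/
theorem sum_cost_le_restrict {ι : Type*} [DecidableEq ι] (cost : ℕ → ℝ)
    (hc1 : ∀ a : ℕ, 1 ≤ a → cost a ≤ Real.log a)
    (hc2 : ∀ a b : ℕ, 1 ≤ b → b ≤ a → cost a - cost b ≤ 2 * (((a - b : ℕ) : ℝ) / b))
    (h : Fin n → ι) (P : Finset (Fin n)) :
    ∑ x : Fin n, cost (univ.filter fun y => h y = h x).card ≤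
      ∑ x' : Fin P.card, cost (univ.filter fun y' : Fin P.card =>
          h ((P.equivFin.symm y' : P) : Fin n) = h ((P.equivFin.symm x' : P) : Fin n)).card
        + (Pᶜ.card : ℝ) * (Real.log n + 2) := by
  -- re-index the restricted sum over `P`
  have hreidx : ∑ x' : Fin P.card, cost (univ.filter fun y' : Fin P.card =>
        h ((P.equivFin.symm y' : P) : Fin n) = h ((P.equivFin.symm x' : P) : Fin n)).card
      = ∑ x ∈ P, cost (P.filter fun y => h y = h x).card := by
    simp_rw [card_block_restrictLab]
    rw [← Finset.sum_coe_sort P (fun x => cost (P.filter fun y => h y = h x).card)]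
    exact Fintype.sum_equiv P.equivFin.symm _ _ (fun x' => rfl)
  rw [hreidx, ← Finset.sum_add_sum_compl P]
  -- outside `P`: `cost ≤ log n`
  have hout : ∑ x ∈ Pᶜ, cost (univ.filter fun y => h y = h x).card ≤ (Pᶜ.card : ℝ) * Real.log n := by
    have hpt : ∀ x ∈ Pᶜ, cost (univ.filter fun y => h y = h x).card ≤ Real.log n := by
      intro x _
      have h1 : 1 ≤ (univ.filter fun y => h y = h x).card := Finset.card_pos.2 ⟨x, by simp⟩
      refine (hc1 _ h1).trans (Real.log_le_log (by exact_mod_cast h1) ?_)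
      have : (univ.filter fun y => h y = h x).card ≤ n := by
        simpa using Finset.card_le_univ (univ.filter fun y => h y = h x)
      exact_mod_cast this
    calc _ ≤ ∑ x ∈ Pᶜ, Real.log n := Finset.sum_le_sum hpt
      _ = (Pᶜ.card : ℝ) * Real.log n := by rw [Finset.sum_const, nsmul_eq_mul]
  -- inside `P`: compare with the restricted blocks
  have hin : ∑ x ∈ P, cost (univ.filter fun y => h y = h x).card ≤
      ∑ x ∈ P, cost (P.filter fun y => h y = h x).card + 2 * (Pᶜ.card : ℝ) := by
    have hpt : ∀ x ∈ P, cost (univ.filter fun y => h y = h x).card ≤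
        cost (P.filter fun y => h y = h x).card +
          2 * ((((Pᶜ.filter fun y => h y = h x).card : ℕ) : ℝ) / (P.filter fun y => h y = h x).card) := by
      intro x hx
      have hb : 1 ≤ (P.filter fun y => h y = h x).card := Finset.card_pos.2 ⟨x, by simp [hx]⟩
      have hsplit := card_block_split h P (h x)
      have hab : (P.filter fun y => h y = h x).card ≤ (univ.filter fun y => h y = h x).card := by omega
      have key := hc2 _ _ hb hab
      have hsub : (univ.filter fun y => h y = h x).card - (P.filter fun y => h y = h x).card =
          (Pᶜ.filter fun y => h y = h x).card := by omega
      rw [hsub] at key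
      linarith
    calc _ ≤ ∑ x ∈ P, (cost (P.filter fun y => h y = h x).card +
          2 * ((((Pᶜ.filter fun y => h y = h x).card : ℕ) : ℝ) / (P.filter fun y => h y = h x).card)) :=
          Finset.sum_le_sum hpt
      _ = ∑ x ∈ P, cost (P.filter fun y => h y = h x).card +
          2 * ∑ x ∈ P, (((Pᶜ.filter fun y => h y = h x).card : ℕ) : ℝ) / (P.filter fun y => h y = h x).card := by
          rw [Finset.sum_add_distrib, Finset.mul_sum]
      _ ≤ _ := by
          have := sum_ratio_le h P
          linarith
  have hring : (Pᶜ.card : ℝ) * (Real.log n + 2) = (Pᶜ.card : ℝ) * Real.log n + 2 * (Pᶜ.card : ℝ) := by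
    ring
  rw [hring]
  linarith [hout, hin]

end Summit.MatrixMultiplication.MatrixMultiplication.Theorems.ThresholdSubsetTriples.Negative
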